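import Summits.HodgeConjecture.CorCM.IrreducibleOddWeightsCommutantDensityShadows
import Summits.HodgeConjecture.CorCM.IrreducibleOddWeightsIsotypicMultiplicityCMFields
import HarnessLib

/-!
# Density over the commutant, V (type ranks and CM fields): THE DEFECT INSIDE AN ISOTYPIC CLASS OF ANY
# IRREDUCIBLE — `(dim Hg(A₀)+dim Hg(A₁)−dim Hg(A₀×A₁)) · δ = dim(D⟨b⟩ ∩ D⟨b′⟩) · dim A`, and the commutant
# certificate «`b′ ∈ D·b`» for one component per side

COR-CM (cell `pub-hodgecm2`, binder seat `b16` gen 72, count-neutral claim DENSITY OVER THE COMMUTANT, file C5 —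
type ranks and CM fields; theorems only, no definition, no named fact, no `sorry`).  NEW as stated, hence under
`Summits/`.  HONEST FRAMING: file C4's class defect for an ARBITRARY commutant read through gen 68's two-pivot
shadow formula (`rank Φ₀ + rank Φ₁ = rank(Φ₀,Φ₁) + 1 + dim(S(w₀) ∩ S(w₁))`); Galois theory of CM fields inside `ℂ`
and linear algebra of odd weights, with consequences for `dim MT(A₀ × A₁)` of abelian varieties with complex
multiplication (Kubota–Dodson rank = `dim MT`, Pohlmann).  It removes «scalar commutant» from gen 70's files
I10/I14/I15 (the case `δ = 1`, `D⟨b⟩ = span_ℚ{b_j}`); nothing is claimed about the algebraicity of Hodge classes;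
`HC_CM` is neither used nor asserted.

SETTING.  Two slots with pivots refining the trace classes (abstract: `r_κ : E_κ → Y_κ`; CM: subfields
`T_κ ⊆ K_{i_κ}` containing the traces, (TR)); BOTH shadows lie in ONE isotypic class built from a reference stable
irreducible `A ≤ ℚ^{Y}` — with commutant `𝒟` (a parameter with its characterising hypothesis) and `δ = dim D·a₀`,
`0 ≠ a₀ ∈ A` — by equivariant, jointly independent embeddings: `w₀ = Σ_j ι⁰_j(b_j)`, `w₁ = Σ_k ι¹_k(b′_k)`.

* `typeRank_add_typeRank_mul_eq_of_commutant`: **`(rank Φ₀ + rank Φ₁)·δ = (rank(Φ₀,Φ₁) + 1)·δ +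
  dim(D⟨b⟩ ∩ D⟨b′⟩)·dim A`**; `typeRank_add_typeRank_eq_iff_of_commutant`: ADDITIVITY **iff `D⟨b⟩ ∩ D⟨b′⟩ = 0`**;
  one component per side, `b, b′ ≠ 0` (`typeRank_add_typeRank_eq_add_ite_of_commutant`): the defect is
  **`dim A` if `b′ ∈ D·b`, else `0`**.
* CM fields: **`cmTypeRank_add_cmTypeRank_mul_eq_of_commutant`**, **`cmTypeRank_add_cmTypeRank_eq_iff_of_commutant`**
  (`Hg(A₀×A₁) = Hg(A₀)×Hg(A₁)` iff the D-spans of the two component tuples meet trivially in the reference module),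
  **`cmTypeRank_add_cmTypeRank_eq_add_ite_of_commutant`** (the COMMUTANT CERTIFICATE: for gen 69's base #552 with
  commutant `ℚ(√2)`, WHICH of `{0, dim A}` occurs is decided by whether `b′ ∈ ℚ(√2)·b`).

## References

* [Gordon1999HodgeAVSurvey] B. B. Gordon, *A survey of the Hodge conjecture for abelian varieties*, §3 Theorem
  (Imai, Murty) with proof, 7.5–7.7, 9.4.3.
* [Lang2002] S. Lang, *Algebra*, 3rd ed., XVII §1 Prop. 1.1, XVII §3.
* [Serre1977] J.-P. Serre, *Linear Representations of Finite Groups*, GTM 42, §2.2, §2.6.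
* [Deligne1982HodgeCycles] P. Deligne, *Hodge cycles on abelian varieties*, LNM 900, I §3 Ex. 3.7.
-/

set_option autoImplicit false

noncomputable section

open scoped BigOperators Classical

universe u u₀ u₁ v v' v'' vY w

namespace Summit.HodgeConjecture.CorCM.IrrOdd

open Literature.NumberTheory.ComplexMultiplication

variable {G : Type w} [Group G] {Y : Type vY} [MulAction G Y] [Fintype Y]
  {Y₀ : Type v'} [MulAction G Y₀] [Fintype Y₀] {Y₁ : Type v''} [MulAction G Y₁] [Fintype Y₁]
  {I : Type u} {E : I → Type v} [∀ i, MulAction G (E i)] [∀ i, Fintype (E i)] [Fintype I] [∀ i, Nonempty (E i)]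

/-! ### §1 Type ranks -/

/-- **THE DEFECT INSIDE AN ISOTYPIC CLASS OF ANY IRREDUCIBLE (type ranks).**  Two slots with equivariant pivots
refining the trace classes; both shadows assembled from a reference stable irreducible `A` — commutant `𝒟`,
`δ = dim D·a₀` — by equivariant, jointly independent embeddings: `w₀ = Σ_j ι⁰_j(b_j)`, `w₁ = Σ_k ι¹_k(b′_k)`.  Then
**`(rank Φ₀ + rank Φ₁)·δ = (rank(Φ₀,Φ₁) + 1)·δ + dim(D⟨b⟩ ∩ D⟨b′⟩)·dim A`**.
[cite: Gordon1999HodgeAVSurvey, §3 Theorem, 7.5–7.7 and 9.4.3] [cite: Lang2002, XVII §3] -/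
theorem typeRank_add_typeRank_mul_eq_of_commutant {ρ : G} {Φ : ∀ i, Set (E i)}
    (h : ∀ i, IsCMTypeWith ρ (Φ i)) {i₀ i₁ : I} (hI : ∀ j, j = i₀ ∨ j = i₁) (h01 : i₀ ≠ i₁)
    (r₀ : E i₀ → Y₀) (r₁ : E i₁ → Y₁) (hr₀ : ∀ (g : G) (x : E i₀), r₀ (g • x) = g • r₀ x)
    (hr₁ : ∀ (g : G) (x : E i₁), r₁ (g • x) = g • r₁ x)
    (hfine₀ : ∀ x x' : E i₀, r₀ x = r₀ x' → ∃ n : G, (∀ y : E i₁, n • y = y) ∧ n • x = x')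
    (hfine₁ : ∀ x x' : E i₁, r₁ x = r₁ x' → ∃ n : G, (∀ y : E i₀, n • y = y) ∧ n • x = x')
    {A : Submodule ℚ (Y → ℚ)} {𝒟 : Submodule ℚ ((Y → ℚ) →ₗ[ℚ] (Y → ℚ))}
    (h𝒟 : ∀ L : (Y → ℚ) →ₗ[ℚ] (Y → ℚ), L ∈ 𝒟 ↔ (∀ a ∈ A, L a ∈ A) ∧
      ∀ (k : G) (a : Y → ℚ), a ∈ A → L (fun y => a (k • y)) = fun y => L a (k • y))
    (hAst : ∀ (k : G) (a : Y → ℚ), a ∈ A → (fun y => a (k • y)) ∈ A)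
    (hAirr : ∀ W : Submodule ℚ (Y → ℚ), W ≤ A → W ≠ ⊥ →
      (∀ (k : G) (f : Y → ℚ), f ∈ W → (fun y => f (k • y)) ∈ W) → W = A)
    {J₀ : Type u₀} {J₁ : Type u₁} [Fintype J₀] [Fintype J₁]
    (ι₀ : J₀ → ((Y → ℚ) →ₗ[ℚ] (Y₀ → ℚ))) (ι₁ : J₁ → ((Y → ℚ) →ₗ[ℚ] (Y₁ → ℚ)))
    (hι₀eq : ∀ (j : J₀) (k : G) (a : Y → ℚ), a ∈ A → ι₀ j (fun y => a (k • y)) = fun y => ι₀ j a (k • y))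
    (hι₁eq : ∀ (j : J₁) (k : G) (a : Y → ℚ), a ∈ A → ι₁ j (fun y => a (k • y)) = fun y => ι₁ j a (k • y))
    (hind₀ : ∀ f : J₀ → (Y → ℚ), (∀ j, f j ∈ A) → ∑ j, ι₀ j (f j) = 0 → ∀ j, f j = 0)
    (hind₁ : ∀ f : J₁ → (Y → ℚ), (∀ j, f j ∈ A) → ∑ j, ι₁ j (f j) = 0 → ∀ j, f j = 0)
    {b₀ : J₀ → (Y → ℚ)} {b₁ : J₁ → (Y → ℚ)} (hb₀ : ∀ j, b₀ j ∈ A) (hb₁ : ∀ j, b₁ j ∈ A)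
    (hw₀ : (fun y : Y₀ => ∑ x ∈ Finset.univ.filter (fun x => r₀ x = y), antiVec (Φ i₀) (1 : G) x) =
      ∑ j, ι₀ j (b₀ j))
    (hw₁ : (fun y : Y₁ => ∑ x ∈ Finset.univ.filter (fun x => r₁ x = y), antiVec (Φ i₁) (1 : G) x) =
      ∑ j, ι₁ j (b₁ j))
    {a₀ : Y → ℚ} (ha₀ : a₀ ∈ A) (h0 : a₀ ≠ 0) :
    (typeRank G (Φ i₀) + typeRank G (Φ i₁)) * Module.finrank ℚ ↥(𝒟.map (LinearMap.applyₗ a₀)) =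
      (typeRank G (sigmaType Φ) + 1) * Module.finrank ℚ ↥(𝒟.map (LinearMap.applyₗ a₀)) +
        Module.finrank ℚ ↥((⨆ j, 𝒟.map (LinearMap.applyₗ (b₀ j))) ⊓ ⨆ j, 𝒟.map (LinearMap.applyₗ (b₁ j))) *
          Module.finrank ℚ A := by
  have hpair := typeRank_add_typeRank_eq_add_finrank_shadowCoeff_inf_shadowCoeff_of_fine h hI h01 r₀ r₁ hr₀ hr₁
    hfine₀ hfine₁
  have e₀ : (fun (y : Y₀) (g : G) => ∑ x ∈ Finset.univ.filter (fun x => r₀ x = g • y), antiVec (Φ i₀) (1 : G) x) =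
      fun (y : Y₀) (g : G) => (∑ j, ι₀ j (b₀ j)) (g • y) := by
    funext y g
    exact congrFun hw₀ (g • y)
  have e₁ : (fun (y : Y₁) (g : G) => ∑ x ∈ Finset.univ.filter (fun x => r₁ x = g • y), antiVec (Φ i₁) (1 : G) x) =
      fun (y : Y₁) (g : G) => (∑ j, ι₁ j (b₁ j)) (g • y) := by
    funext y g
    exact congrFun hw₁ (g • y)
  rw [e₀, e₁] at hpair
  rw [hpair, add_mul,
    finrank_span_shadowCoeff_inf_mul_eq h𝒟 hAst hAirr ι₀ ι₁ hι₀eq hι₁eq hind₀ hind₁ hb₀ hb₁ ha₀ h0]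

/-- **ADDITIVITY IFF THE D-SPANS MEET TRIVIALLY (type ranks)**: for `A ≠ 0`,
`rank Φ₀ + rank Φ₁ = rank(Φ₀,Φ₁) + 1 ⟺ D⟨b⟩ ∩ D⟨b′⟩ = 0`. [cite: Gordon1999HodgeAVSurvey, §3 Theorem, 7.5–7.7
and 9.4.3] [cite: Lang2002, XVII §3] -/
theorem typeRank_add_typeRank_eq_iff_of_commutant {ρ : G} {Φ : ∀ i, Set (E i)}
    (h : ∀ i, IsCMTypeWith ρ (Φ i)) {i₀ i₁ : I} (hI : ∀ j, j = i₀ ∨ j = i₁) (h01 : i₀ ≠ i₁)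
    (r₀ : E i₀ → Y₀) (r₁ : E i₁ → Y₁) (hr₀ : ∀ (g : G) (x : E i₀), r₀ (g • x) = g • r₀ x)
    (hr₁ : ∀ (g : G) (x : E i₁), r₁ (g • x) = g • r₁ x)
    (hfine₀ : ∀ x x' : E i₀, r₀ x = r₀ x' → ∃ n : G, (∀ y : E i₁, n • y = y) ∧ n • x = x')
    (hfine₁ : ∀ x x' : E i₁, r₁ x = r₁ x' → ∃ n : G, (∀ y : E i₀, n • y = y) ∧ n • x = x')
    {A : Submodule ℚ (Y → ℚ)} {𝒟 : Submodule ℚ ((Y → ℚ) →ₗ[ℚ] (Y → ℚ))}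
    (h𝒟 : ∀ L : (Y → ℚ) →ₗ[ℚ] (Y → ℚ), L ∈ 𝒟 ↔ (∀ a ∈ A, L a ∈ A) ∧
      ∀ (k : G) (a : Y → ℚ), a ∈ A → L (fun y => a (k • y)) = fun y => L a (k • y))
    (hAst : ∀ (k : G) (a : Y → ℚ), a ∈ A → (fun y => a (k • y)) ∈ A)
    (hAirr : ∀ W : Submodule ℚ (Y → ℚ), W ≤ A → W ≠ ⊥ →
      (∀ (k : G) (f : Y → ℚ), f ∈ W → (fun y => f (k • y)) ∈ W) → W = A)
    (hA0 : A ≠ ⊥) {J₀ : Type u₀} {J₁ : Type u₁} [Fintype J₀] [Fintype J₁]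
    (ι₀ : J₀ → ((Y → ℚ) →ₗ[ℚ] (Y₀ → ℚ))) (ι₁ : J₁ → ((Y → ℚ) →ₗ[ℚ] (Y₁ → ℚ)))
    (hι₀eq : ∀ (j : J₀) (k : G) (a : Y → ℚ), a ∈ A → ι₀ j (fun y => a (k • y)) = fun y => ι₀ j a (k • y))
    (hι₁eq : ∀ (j : J₁) (k : G) (a : Y → ℚ), a ∈ A → ι₁ j (fun y => a (k • y)) = fun y => ι₁ j a (k • y))
    (hind₀ : ∀ f : J₀ → (Y → ℚ), (∀ j, f j ∈ A) → ∑ j, ι₀ j (f j) = 0 → ∀ j, f j = 0)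
    (hind₁ : ∀ f : J₁ → (Y → ℚ), (∀ j, f j ∈ A) → ∑ j, ι₁ j (f j) = 0 → ∀ j, f j = 0)
    {b₀ : J₀ → (Y → ℚ)} {b₁ : J₁ → (Y → ℚ)} (hb₀ : ∀ j, b₀ j ∈ A) (hb₁ : ∀ j, b₁ j ∈ A)
    (hw₀ : (fun y : Y₀ => ∑ x ∈ Finset.univ.filter (fun x => r₀ x = y), antiVec (Φ i₀) (1 : G) x) =
      ∑ j, ι₀ j (b₀ j))
    (hw₁ : (fun y : Y₁ => ∑ x ∈ Finset.univ.filter (fun x => r₁ x = y), antiVec (Φ i₁) (1 : G) x) =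
      ∑ j, ι₁ j (b₁ j)) :
    typeRank G (Φ i₀) + typeRank G (Φ i₁) = typeRank G (sigmaType Φ) + 1 ↔
      (⨆ j, 𝒟.map (LinearMap.applyₗ (b₀ j))) ⊓ (⨆ j, 𝒟.map (LinearMap.applyₗ (b₁ j))) = ⊥ := by
  have hpair := typeRank_add_typeRank_eq_add_finrank_shadowCoeff_inf_shadowCoeff_of_fine h hI h01 r₀ r₁ hr₀ hr₁
    hfine₀ hfine₁
  have e₀ : (fun (y : Y₀) (g : G) => ∑ x ∈ Finset.univ.filter (fun x => r₀ x = g • y), antiVec (Φ i₀) (1 : G) x) =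
      fun (y : Y₀) (g : G) => (∑ j, ι₀ j (b₀ j)) (g • y) := by
    funext y g
    exact congrFun hw₀ (g • y)
  have e₁ : (fun (y : Y₁) (g : G) => ∑ x ∈ Finset.univ.filter (fun x => r₁ x = g • y), antiVec (Φ i₁) (1 : G) x) =
      fun (y : Y₁) (g : G) => (∑ j, ι₁ j (b₁ j)) (g • y) := by
    funext y g
    exact congrFun hw₁ (g • y)
  rw [e₀, e₁] at hpair
  haveI : FiniteDimensional ℚ ↥(Submodule.span ℚ (Set.range fun y : Y₀ => fun g : G =>
      (∑ j, ι₀ j (b₀ j)) (g • y))) := FiniteDimensional.span_of_finite ℚ (Set.finite_range _)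
  haveI : FiniteDimensional ℚ ↥(Submodule.span ℚ (Set.range fun y : Y₀ => fun g : G =>
      (∑ j, ι₀ j (b₀ j)) (g • y)) ⊓ Submodule.span ℚ (Set.range fun y : Y₁ => fun g : G =>
      (∑ j, ι₁ j (b₁ j)) (g • y))) := Submodule.finiteDimensional_of_le inf_le_left
  rw [← span_shadowCoeff_inf_eq_bot_iff_iSup h𝒟 hAst hAirr hA0 ι₀ ι₁ hι₀eq hι₁eq hind₀ hind₁ hb₀ hb₁, hpair,
    ← Submodule.finrank_eq_zero]
  omega

/-- **ONE COMPONENT PER SIDE — THE COMMUTANT CERTIFICATE (type ranks)**: `w₀ = ι(b)`, `w₁ = ι′(b′)` with `b, b′ ≠ 0`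
in `A`: `rank Φ₀ + rank Φ₁ = rank(Φ₀,Φ₁) + 1 + (dim A if b′ ∈ D·b, else 0)`.
[cite: Gordon1999HodgeAVSurvey, §3 Theorem, 7.5–7.7 and 9.4.3] [cite: CurtisReiner1962, §27 (27.3)] -/
theorem typeRank_add_typeRank_eq_add_ite_of_commutant {ρ : G} {Φ : ∀ i, Set (E i)}
    (h : ∀ i, IsCMTypeWith ρ (Φ i)) {i₀ i₁ : I} (hI : ∀ j, j = i₀ ∨ j = i₁) (h01 : i₀ ≠ i₁)
    (r₀ : E i₀ → Y₀) (r₁ : E i₁ → Y₁) (hr₀ : ∀ (g : G) (x : E i₀), r₀ (g • x) = g • r₀ x)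
    (hr₁ : ∀ (g : G) (x : E i₁), r₁ (g • x) = g • r₁ x)
    (hfine₀ : ∀ x x' : E i₀, r₀ x = r₀ x' → ∃ n : G, (∀ y : E i₁, n • y = y) ∧ n • x = x')
    (hfine₁ : ∀ x x' : E i₁, r₁ x = r₁ x' → ∃ n : G, (∀ y : E i₀, n • y = y) ∧ n • x = x')
    {A : Submodule ℚ (Y → ℚ)} {𝒟 : Submodule ℚ ((Y → ℚ) →ₗ[ℚ] (Y → ℚ))}
    (h𝒟 : ∀ L : (Y → ℚ) →ₗ[ℚ] (Y → ℚ), L ∈ 𝒟 ↔ (∀ a ∈ A, L a ∈ A) ∧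
      ∀ (k : G) (a : Y → ℚ), a ∈ A → L (fun y => a (k • y)) = fun y => L a (k • y))
    (hAst : ∀ (k : G) (a : Y → ℚ), a ∈ A → (fun y => a (k • y)) ∈ A)
    (hAirr : ∀ W : Submodule ℚ (Y → ℚ), W ≤ A → W ≠ ⊥ →
      (∀ (k : G) (f : Y → ℚ), f ∈ W → (fun y => f (k • y)) ∈ W) → W = A)
    (ι₀ : (Y → ℚ) →ₗ[ℚ] (Y₀ → ℚ)) (ι₁ : (Y → ℚ) →ₗ[ℚ] (Y₁ → ℚ))
    (hι₀eq : ∀ (k : G) (a : Y → ℚ), a ∈ A → ι₀ (fun y => a (k • y)) = fun y => ι₀ a (k • y))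
    (hι₁eq : ∀ (k : G) (a : Y → ℚ), a ∈ A → ι₁ (fun y => a (k • y)) = fun y => ι₁ a (k • y))
    (hinj₀ : ∀ f ∈ A, ι₀ f = 0 → f = 0) (hinj₁ : ∀ f ∈ A, ι₁ f = 0 → f = 0)
    {b₀ b₁ : Y → ℚ} (hb₀ : b₀ ∈ A) (hb₀0 : b₀ ≠ 0) (hb₁ : b₁ ∈ A) (hb₁0 : b₁ ≠ 0)
    (hw₀ : (fun y : Y₀ => ∑ x ∈ Finset.univ.filter (fun x => r₀ x = y), antiVec (Φ i₀) (1 : G) x) = ι₀ b₀)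
    (hw₁ : (fun y : Y₁ => ∑ x ∈ Finset.univ.filter (fun x => r₁ x = y), antiVec (Φ i₁) (1 : G) x) = ι₁ b₁) :
    typeRank G (Φ i₀) + typeRank G (Φ i₁) = typeRank G (sigmaType Φ) + 1 +
      if b₁ ∈ 𝒟.map (LinearMap.applyₗ b₀) then Module.finrank ℚ A else 0 := by
  have hpair := typeRank_add_typeRank_eq_add_finrank_shadowCoeff_inf_shadowCoeff_of_fine h hI h01 r₀ r₁ hr₀ hr₁
    hfine₀ hfine₁
  have e₀ : (fun (y : Y₀) (g : G) => ∑ x ∈ Finset.univ.filter (fun x => r₀ x = g • y), antiVec (Φ i₀) (1 : G) x) =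
      fun (y : Y₀) (g : G) => ι₀ b₀ (g • y) := by
    funext y g
    exact congrFun hw₀ (g • y)
  have e₁ : (fun (y : Y₁) (g : G) => ∑ x ∈ Finset.univ.filter (fun x => r₁ x = g • y), antiVec (Φ i₁) (1 : G) x) =
      fun (y : Y₁) (g : G) => ι₁ b₁ (g • y) := by
    funext y g
    exact congrFun hw₁ (g • y)
  rw [e₀, e₁] at hpair
  rw [hpair, finrank_span_shadowCoeff_inf_eq_ite_single h𝒟 hAst hAirr ι₀ ι₁ hι₀eq hι₁eq hinj₀ hinj₁ hb₀ hb₀0 hb₁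
    hb₁0]

end Summit.HodgeConjecture.CorCM.IrrOdd

/-! ### §2 CM fields -/

namespace Summit.HodgeConjecture.CorCM

open CategoryTheory CategoryTheory.Limits NumberField Module IntermediateField
open Literature.NumberTheory.ComplexMultiplication
open Literature.AlgebraicGeometry.Motives (AbelianVariety CMType)
open Literature.AlgebraicGeometry.Motives.AbelianVariety
open Literature.AlgebraicGeometry.HodgeTheory
open Literature.AlgebraicGeometry.ComplexMultiplication (IsCMTypeRealisation)
open Literature.AlgebraicGeometry.Pohlmann1968

variable {I : Type} [Fintype I] {K : I → Type} [∀ i, Field (K i)] [∀ i, NumberField (K i)] [∀ i, IsCMField (K i)]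
  {T₀ : Type} [Field T₀] [NumberField T₀] {T₁ : Type} [Field T₁] [NumberField T₁]
  {Y : Type vY} [MulAction (ℂ ≃+* ℂ) Y] [Fintype Y]

/-- **THE DEFECT INSIDE AN ISOTYPIC CLASS OF ANY IRREDUCIBLE (CM fields).**  `T₀ ⊆ K_{i₀}`, `T₁ ⊆ K_{i₁}` subfields
containing the traces (TR); both shadows `w_κ` on `Hom(T_κ, ℂ)` assembled from a reference `Aut(ℂ)`-stable
irreducible `A ≤ ℚ^{Y}` with commutant `𝒟` (ANY), `δ = dim D·a₀`, by equivariant, jointly independent embeddings: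
`w₀ = Σ_j ι⁰_j(b_j)`, `w₁ = Σ_k ι¹_k(b′_k)`.  Then
**`(cmTypeRank Φ₀ + cmTypeRank Φ₁)·δ = (cmFamilyRank Φ + 1)·δ + dim(D⟨b⟩ ∩ D⟨b′⟩)·dim A`** — the defect
`dim Hg(A₀)+dim Hg(A₁)−dim Hg(A₀×A₁)`, times `δ`, counts the D-relations between the components of the two shadows.
[cite: Gordon1999HodgeAVSurvey, §3 Theorem, 7.5–7.7 and 9.4.3] [cite: Lang2002, XVII §3] [cite: Serre1977, §2.6] -/
theorem cmTypeRank_add_cmTypeRank_mul_eq_of_commutant {i₀ i₁ : I} (h01 : i₀ ≠ i₁) (hI : ∀ l, l = i₀ ∨ l = i₁)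
    (Φ : ∀ i, CMType (K i)) [Algebra T₀ (K i₀)] [Algebra T₁ (K i₁)]
    (htr₀ : ∀ (a : K i₀ →+* ℂ) (k : K i₀), a k ∈ normalClosure ℚ (K i₁) ℂ → k ∈ Set.range (algebraMap T₀ (K i₀)))
    (htr₁ : ∀ (b : K i₁ →+* ℂ) (k : K i₁), b k ∈ normalClosure ℚ (K i₀) ℂ → k ∈ Set.range (algebraMap T₁ (K i₁)))
    {A : Submodule ℚ (Y → ℚ)} {𝒟 : Submodule ℚ ((Y → ℚ) →ₗ[ℚ] (Y → ℚ))}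
    (h𝒟 : ∀ L : (Y → ℚ) →ₗ[ℚ] (Y → ℚ), L ∈ 𝒟 ↔ (∀ a ∈ A, L a ∈ A) ∧
      ∀ (k : ℂ ≃+* ℂ) (a : Y → ℚ), a ∈ A → L (fun y => a (k • y)) = fun y => L a (k • y))
    (hAst : ∀ (k : ℂ ≃+* ℂ) (a : Y → ℚ), a ∈ A → (fun y => a (k • y)) ∈ A)
    (hAirr : ∀ W : Submodule ℚ (Y → ℚ), W ≤ A → W ≠ ⊥ →
      (∀ (k : ℂ ≃+* ℂ) (f : Y → ℚ), f ∈ W → (fun y => f (k • y)) ∈ W) → W = A)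
    {J₀ J₁ : Type} [Fintype J₀] [Fintype J₁]
    (ι₀ : J₀ → ((Y → ℚ) →ₗ[ℚ] ((T₀ →+* ℂ) → ℚ))) (ι₁ : J₁ → ((Y → ℚ) →ₗ[ℚ] ((T₁ →+* ℂ) → ℚ)))
    (hι₀eq : ∀ (j : J₀) (k : ℂ ≃+* ℂ) (a : Y → ℚ), a ∈ A → ι₀ j (fun y => a (k • y)) = fun y => ι₀ j a (k • y))
    (hι₁eq : ∀ (j : J₁) (k : ℂ ≃+* ℂ) (a : Y → ℚ), a ∈ A → ι₁ j (fun y => a (k • y)) = fun y => ι₁ j a (k • y))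
    (hind₀ : ∀ f : J₀ → (Y → ℚ), (∀ j, f j ∈ A) → ∑ j, ι₀ j (f j) = 0 → ∀ j, f j = 0)
    (hind₁ : ∀ f : J₁ → (Y → ℚ), (∀ j, f j ∈ A) → ∑ j, ι₁ j (f j) = 0 → ∀ j, f j = 0)
    {b₀ : J₀ → (Y → ℚ)} {b₁ : J₁ → (Y → ℚ)} (hb₀ : ∀ j, b₀ j ∈ A) (hb₁ : ∀ j, b₁ j ∈ A)
    (hw₀ : (fun y : T₀ →+* ℂ => ∑ t ∈ Finset.univ.filter (fun t : K i₀ →+* ℂ => t.comp (algebraMap T₀ (K i₀)) = y),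
        antiVec (Φ i₀).1 (1 : ℂ ≃+* ℂ) t) = ∑ j, ι₀ j (b₀ j))
    (hw₁ : (fun y : T₁ →+* ℂ => ∑ t ∈ Finset.univ.filter (fun t : K i₁ →+* ℂ => t.comp (algebraMap T₁ (K i₁)) = y),
        antiVec (Φ i₁).1 (1 : ℂ ≃+* ℂ) t) = ∑ j, ι₁ j (b₁ j))
    {a₀ : Y → ℚ} (ha₀ : a₀ ∈ A) (h0 : a₀ ≠ 0) :
    (cmTypeRank (Φ i₀) + cmTypeRank (Φ i₁)) * Module.finrank ℚ ↥(𝒟.map (LinearMap.applyₗ a₀)) =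
      (CMAlgebra.cmFamilyRank Φ + 1) * Module.finrank ℚ ↥(𝒟.map (LinearMap.applyₗ a₀)) +
        Module.finrank ℚ ↥((⨆ j, 𝒟.map (LinearMap.applyₗ (b₀ j))) ⊓ ⨆ j, 𝒟.map (LinearMap.applyₗ (b₁ j))) *
          Module.finrank ℚ A := by
  haveI : ∀ i, Nonempty (K i →+* ℂ) := fun i => inferInstance
  exact IrrOdd.typeRank_add_typeRank_mul_eq_of_commutant (G := ℂ ≃+* ℂ) (E := fun i => K i →+* ℂ)
    (Φ := fun i => (Φ i).1) (fun i => isCMTypeWith_conj (Φ i)) hI h01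
    (fun t : K i₀ →+* ℂ => t.comp (algebraMap T₀ (K i₀))) (fun t : K i₁ →+* ℂ => t.comp (algebraMap T₁ (K i₁)))
    (fun _ _ => rfl) (fun _ _ => rfl) (exists_stab_smul_eq_of_comp_eq_of_trace_le i₁ htr₀)
    (exists_stab_smul_eq_of_comp_eq_of_trace_le i₀ htr₁) h𝒟 hAst hAirr ι₀ ι₁ hι₀eq hι₁eq hind₀ hind₁ hb₀ hb₁
    hw₀ hw₁ ha₀ h0

/-- **ADDITIVITY IFF THE D-SPANS MEET TRIVIALLY (CM fields)**: in the same setting with `A ≠ 0`,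
**`cmTypeRank Φ₀ + cmTypeRank Φ₁ = cmFamilyRank Φ + 1` (i.e. `Hg(A₀×A₁) = Hg(A₀)×Hg(A₁)`)
`⟺ D⟨b⟩ ∩ D⟨b′⟩ = 0`** in the reference module.
[cite: Gordon1999HodgeAVSurvey, §3 Theorem, 7.5–7.7 and 9.4.3] [cite: Lang2002, XVII §3] [cite: Serre1977, §2.6] -/
theorem cmTypeRank_add_cmTypeRank_eq_iff_of_commutant {i₀ i₁ : I} (h01 : i₀ ≠ i₁) (hI : ∀ l, l = i₀ ∨ l = i₁)
    (Φ : ∀ i, CMType (K i)) [Algebra T₀ (K i₀)] [Algebra T₁ (K i₁)]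
    (htr₀ : ∀ (a : K i₀ →+* ℂ) (k : K i₀), a k ∈ normalClosure ℚ (K i₁) ℂ → k ∈ Set.range (algebraMap T₀ (K i₀)))
    (htr₁ : ∀ (b : K i₁ →+* ℂ) (k : K i₁), b k ∈ normalClosure ℚ (K i₀) ℂ → k ∈ Set.range (algebraMap T₁ (K i₁)))
    {A : Submodule ℚ (Y → ℚ)} {𝒟 : Submodule ℚ ((Y → ℚ) →ₗ[ℚ] (Y → ℚ))}
    (h𝒟 : ∀ L : (Y → ℚ) →ₗ[ℚ] (Y → ℚ), L ∈ 𝒟 ↔ (∀ a ∈ A, L a ∈ A) ∧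
      ∀ (k : ℂ ≃+* ℂ) (a : Y → ℚ), a ∈ A → L (fun y => a (k • y)) = fun y => L a (k • y))
    (hAst : ∀ (k : ℂ ≃+* ℂ) (a : Y → ℚ), a ∈ A → (fun y => a (k • y)) ∈ A)
    (hAirr : ∀ W : Submodule ℚ (Y → ℚ), W ≤ A → W ≠ ⊥ →
      (∀ (k : ℂ ≃+* ℂ) (f : Y → ℚ), f ∈ W → (fun y => f (k • y)) ∈ W) → W = A)
    (hA0 : A ≠ ⊥) {J₀ J₁ : Type} [Fintype J₀] [Fintype J₁]
    (ι₀ : J₀ → ((Y → ℚ) →ₗ[ℚ] ((T₀ →+* ℂ) → ℚ))) (ι₁ : J₁ → ((Y → ℚ) →ₗ[ℚ] ((T₁ →+* ℂ) → ℚ)))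
    (hι₀eq : ∀ (j : J₀) (k : ℂ ≃+* ℂ) (a : Y → ℚ), a ∈ A → ι₀ j (fun y => a (k • y)) = fun y => ι₀ j a (k • y))
    (hι₁eq : ∀ (j : J₁) (k : ℂ ≃+* ℂ) (a : Y → ℚ), a ∈ A → ι₁ j (fun y => a (k • y)) = fun y => ι₁ j a (k • y))
    (hind₀ : ∀ f : J₀ → (Y → ℚ), (∀ j, f j ∈ A) → ∑ j, ι₀ j (f j) = 0 → ∀ j, f j = 0)
    (hind₁ : ∀ f : J₁ → (Y → ℚ), (∀ j, f j ∈ A) → ∑ j, ι₁ j (f j) = 0 → ∀ j, f j = 0)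
    {b₀ : J₀ → (Y → ℚ)} {b₁ : J₁ → (Y → ℚ)} (hb₀ : ∀ j, b₀ j ∈ A) (hb₁ : ∀ j, b₁ j ∈ A)
    (hw₀ : (fun y : T₀ →+* ℂ => ∑ t ∈ Finset.univ.filter (fun t : K i₀ →+* ℂ => t.comp (algebraMap T₀ (K i₀)) = y),
        antiVec (Φ i₀).1 (1 : ℂ ≃+* ℂ) t) = ∑ j, ι₀ j (b₀ j))
    (hw₁ : (fun y : T₁ →+* ℂ => ∑ t ∈ Finset.univ.filter (fun t : K i₁ →+* ℂ => t.comp (algebraMap T₁ (K i₁)) = y),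
        antiVec (Φ i₁).1 (1 : ℂ ≃+* ℂ) t) = ∑ j, ι₁ j (b₁ j)) :
    cmTypeRank (Φ i₀) + cmTypeRank (Φ i₁) = CMAlgebra.cmFamilyRank Φ + 1 ↔
      (⨆ j, 𝒟.map (LinearMap.applyₗ (b₀ j))) ⊓ (⨆ j, 𝒟.map (LinearMap.applyₗ (b₁ j))) = ⊥ := by
  haveI : ∀ i, Nonempty (K i →+* ℂ) := fun i => inferInstance
  exact IrrOdd.typeRank_add_typeRank_eq_iff_of_commutant (G := ℂ ≃+* ℂ) (E := fun i => K i →+* ℂ)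
    (Φ := fun i => (Φ i).1) (fun i => isCMTypeWith_conj (Φ i)) hI h01
    (fun t : K i₀ →+* ℂ => t.comp (algebraMap T₀ (K i₀))) (fun t : K i₁ →+* ℂ => t.comp (algebraMap T₁ (K i₁)))
    (fun _ _ => rfl) (fun _ _ => rfl) (exists_stab_smul_eq_of_comp_eq_of_trace_le i₁ htr₀)
    (exists_stab_smul_eq_of_comp_eq_of_trace_le i₀ htr₁) h𝒟 hAst hAirr hA0 ι₀ ι₁ hι₀eq hι₁eq hind₀ hind₁ hb₀ hb₁
    hw₀ hw₁

/-- **THE COMMUTANT CERTIFICATE (CM fields)**: one component per side (`w₀ = ι(b)`, `w₁ = ι′(b′)`, `b, b′ ≠ 0` in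
the reference module `A` with commutant `𝒟`):
**`cmTypeRank Φ₀ + cmTypeRank Φ₁ = cmFamilyRank Φ + 1 + (dim A if b′ ∈ D·b, else 0)`** — the pair is NON-additive
exactly when `b′` lies on the D-LINE of `b` (gen 69 Q3/Q4 is the case `D = ℚ`; for base #552 `D = ℚ(√2)`).
[cite: Gordon1999HodgeAVSurvey, §3 Theorem, 7.5–7.7 and 9.4.3] [cite: CurtisReiner1962, §27 (27.3)]
[cite: Lang2002, XVII §3] -/
theorem cmTypeRank_add_cmTypeRank_eq_add_ite_of_commutant {i₀ i₁ : I} (h01 : i₀ ≠ i₁) (hI : ∀ l, l = i₀ ∨ l = i₁)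
    (Φ : ∀ i, CMType (K i)) [Algebra T₀ (K i₀)] [Algebra T₁ (K i₁)]
    (htr₀ : ∀ (a : K i₀ →+* ℂ) (k : K i₀), a k ∈ normalClosure ℚ (K i₁) ℂ → k ∈ Set.range (algebraMap T₀ (K i₀)))
    (htr₁ : ∀ (b : K i₁ →+* ℂ) (k : K i₁), b k ∈ normalClosure ℚ (K i₀) ℂ → k ∈ Set.range (algebraMap T₁ (K i₁)))
    {A : Submodule ℚ (Y → ℚ)} {𝒟 : Submodule ℚ ((Y → ℚ) →ₗ[ℚ] (Y → ℚ))}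
    (h𝒟 : ∀ L : (Y → ℚ) →ₗ[ℚ] (Y → ℚ), L ∈ 𝒟 ↔ (∀ a ∈ A, L a ∈ A) ∧
      ∀ (k : ℂ ≃+* ℂ) (a : Y → ℚ), a ∈ A → L (fun y => a (k • y)) = fun y => L a (k • y))
    (hAst : ∀ (k : ℂ ≃+* ℂ) (a : Y → ℚ), a ∈ A → (fun y => a (k • y)) ∈ A)
    (hAirr : ∀ W : Submodule ℚ (Y → ℚ), W ≤ A → W ≠ ⊥ →
      (∀ (k : ℂ ≃+* ℂ) (f : Y → ℚ), f ∈ W → (fun y => f (k • y)) ∈ W) → W = A)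
    (ι₀ : (Y → ℚ) →ₗ[ℚ] ((T₀ →+* ℂ) → ℚ)) (ι₁ : (Y → ℚ) →ₗ[ℚ] ((T₁ →+* ℂ) → ℚ))
    (hι₀eq : ∀ (k : ℂ ≃+* ℂ) (a : Y → ℚ), a ∈ A → ι₀ (fun y => a (k • y)) = fun y => ι₀ a (k • y))
    (hι₁eq : ∀ (k : ℂ ≃+* ℂ) (a : Y → ℚ), a ∈ A → ι₁ (fun y => a (k • y)) = fun y => ι₁ a (k • y))
    (hinj₀ : ∀ f ∈ A, ι₀ f = 0 → f = 0) (hinj₁ : ∀ f ∈ A, ι₁ f = 0 → f = 0)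
    {b₀ b₁ : Y → ℚ} (hb₀ : b₀ ∈ A) (hb₀0 : b₀ ≠ 0) (hb₁ : b₁ ∈ A) (hb₁0 : b₁ ≠ 0)
    (hw₀ : (fun y : T₀ →+* ℂ => ∑ t ∈ Finset.univ.filter (fun t : K i₀ →+* ℂ => t.comp (algebraMap T₀ (K i₀)) = y),
        antiVec (Φ i₀).1 (1 : ℂ ≃+* ℂ) t) = ι₀ b₀)
    (hw₁ : (fun y : T₁ →+* ℂ => ∑ t ∈ Finset.univ.filter (fun t : K i₁ →+* ℂ => t.comp (algebraMap T₁ (K i₁)) = y),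
        antiVec (Φ i₁).1 (1 : ℂ ≃+* ℂ) t) = ι₁ b₁) :
    cmTypeRank (Φ i₀) + cmTypeRank (Φ i₁) = CMAlgebra.cmFamilyRank Φ + 1 +
      if b₁ ∈ 𝒟.map (LinearMap.applyₗ b₀) then Module.finrank ℚ A else 0 := by
  haveI : ∀ i, Nonempty (K i →+* ℂ) := fun i => inferInstance
  exact IrrOdd.typeRank_add_typeRank_eq_add_ite_of_commutant (G := ℂ ≃+* ℂ) (E := fun i => K i →+* ℂ)
    (Φ := fun i => (Φ i).1) (fun i => isCMTypeWith_conj (Φ i)) hI h01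
    (fun t : K i₀ →+* ℂ => t.comp (algebraMap T₀ (K i₀))) (fun t : K i₁ →+* ℂ => t.comp (algebraMap T₁ (K i₁)))
    (fun _ _ => rfl) (fun _ _ => rfl) (exists_stab_smul_eq_of_comp_eq_of_trace_le i₁ htr₀)
    (exists_stab_smul_eq_of_comp_eq_of_trace_le i₀ htr₁) h𝒟 hAst hAirr ι₀ ι₁ hι₀eq hι₁eq hinj₀ hinj₁ hb₀ hb₀0 hb₁
    hb₁0 hw₀ hw₁

end Summit.HodgeConjecture.CorCM

end
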